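import Summits.Ventures.HSemireg.WedgeHankelRecurrenceGaussElectrostaticMoments

/-!
# Venture HSemireg — **THE HERMITE ZEROS ARE `±√(2z)` OVER THE LAGUERRE `∓½` ZEROS**: with N376 (`He_{2n} = (2^n L^{(−½)}_n(X∕2))(X²)`, `He_{2n+1} = X·(2^n L^{(½)}_n(X∕2))(X²)`), the scaling N324 and
# the factorisation `(∏(X − w))(X²) = ∏(X − √w)(X + √w)` (N374): **`He_{2t+2} = ∏_k (X − √(2z_k)) · ∏_k (X + √(2z_k))`** over the zeros `0 < z_0 < ⋯ < z_t` of `L^{(−½)}_{t+1}`, and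
# **`He_{2t+3} = X · ∏_k (X − √(2z'_k)) · ∏_k (X + √(2z'_k))`** over the zeros `z'` of `L^{(½)}_{t+1}` — the positive zeros of `He_m` are `√(2·(Laguerre zeros))`

HONEST FRAMING. Part of the Lean index of the computation cell `pub-hsemireg` (seat p10 gen 46, Sunday typer «UNIFORM-IN-n»).  Real polynomials and `Real.sqrt` only; no variety, no cohomology theory, no
sheaf, no Ext group and no semiregularity map is constructed here; nothing here says that HC / HC_CM / HC_AV holds; no Literature fact (unproved `Prop`) is declared or used.  Custodian versions as in
`WedgeHankelSiegelIdeal` (1/3).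
SOURCES (cited).  G. Szegő, *Orthogonal Polynomials*, (5.6.1) and §6.31 (zeros of Hermite via Laguerre `±½`); M. Abramowitz, I. Stegun, *Handbook*, 22.5.40–41; T. S. Chihara, *An Introduction to
Orthogonal Polynomials* (1978), Ch. I Thm 8.1 ∕ §9.
PROOF TYPED HERE.  N376 `hermite_even_odd_laguerre`; N324 `recurrence_scale_spec` (`c = 2`: `2^{t+1} L_{t+1}(X∕2) = ∏ (X − 2 z_k)`); N374 `comp_X_sq_prod_eq` with `2 z_k ≥ 0` (N376 `laguerre_zeros_pos`).
DEDUP DISCLOSURE (`rg -n 'hermite_even_zeros|hermite_odd_zeros|sqrt \\(2 \\*' Summits/Ventures/HSemireg`, 2026-09-03): N376 gives the polynomial identity, N359 the Hermite zeros abstractly; the explicit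
`±√(2z)` factorisation is new.  The 2 names below: 0 hits tree-wide.

WHAT IS IN THE TREE.  N376 `hermite_even_odd_laguerre`, `laguerre_zeros_pos`; N324 `recurrence_scale_spec`; N374 `comp_X_sq_prod_eq`.
THIS FILE (namespace `Summit.Ventures.HSemireg.Wedge.HankelOuter` continued; CHAINED on N399 (import only); 0 definitions):
* §1165 **`hermite_even_zeros_laguerre`**, **`hermite_odd_zeros_laguerre`**.
CAVEATS.  The Laguerre `∓½` families enter through their recurrences (`a_n = 2n + ½`, `b_{n+1} = (n+1)(n+½)`; `a_n = 2n + 3∕2`, `b_{n+1} = (n+1)(n+3∕2)`).  Nothing Ext-side.  New names only.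
-/

open Module Polynomial
open scoped Matrix Polynomial

namespace Summit.Ventures.HSemireg.Wedge.HankelOuter

/-! ## §1165. Hermite zeros from Laguerre zeros -/

/-- **`He_{2t+2} = ∏_k (X − √(2 z_k)) · ∏_k (X − (−√(2 z_k)))`** where `L^{(−½)}_{t+1} = ∏_k (X − z_k)` with `z_k ≥ 0` (e.g. the increasing positive zeros of N376). [Szegő (5.6.1), §6.31; this file,
§1165] -/
theorem hermite_even_zeros_laguerre {L L' : ℕ → ℝ[X]} {a b a' b' : ℕ → ℝ} (hL0 : L 0 = 1) (hL1 : L 1 = Polynomial.X - C (a 0))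
    (hLrec : ∀ n, L (n + 2) = (Polynomial.X - C (a (n + 1))) * L (n + 1) - C (b (n + 1)) * L n) (ha : ∀ n, a n = 2 * n + 1 / 2)
    (hb : ∀ n, b (n + 1) = ((n : ℝ) + 1) * ((n : ℝ) + 1 / 2))
    (hL0' : L' 0 = 1) (hL1' : L' 1 = Polynomial.X - C (a' 0)) (hLrec' : ∀ n, L' (n + 2) = (Polynomial.X - C (a' (n + 1))) * L' (n + 1) - C (b' (n + 1)) * L' n)
    (ha' : ∀ n, a' n = 2 * n + 3 / 2) (hb' : ∀ n, b' (n + 1) = ((n : ℝ) + 1) * ((n : ℝ) + 3 / 2))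
    {t : ℕ} {z : Fin (t + 1) → ℝ} (hz : ∀ k, 0 ≤ z k) (hzq : L (t + 1) = ∏ k, (Polynomial.X - C (z k))) :
    (Polynomial.hermite (2 * (t + 1))).map (Int.castRingHom ℝ) = (∏ k, (Polynomial.X - C (Real.sqrt (2 * z k)))) * ∏ k, (Polynomial.X - C (-Real.sqrt (2 * z k))) := by
  obtain ⟨heven, -⟩ := hermite_even_odd_laguerre hL0 hL1 hLrec ha hb hL0' hL1' hLrec' ha' hb' (t + 1)
  obtain ⟨-, -, -, hprod⟩ := recurrence_scale_spec hL0 hL1 hLrec (c := 2) two_ne_zero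
  rw [heven, hprod hzq]
  exact comp_X_sq_prod_eq fun k => by have := hz k; positivity

/-- **`He_{2t+3} = X · ∏_k (X − √(2 z'_k)) · ∏_k (X − (−√(2 z'_k)))`** where `L^{(½)}_{t+1} = ∏_k (X − z'_k)` with `z'_k ≥ 0`. [Szegő (5.6.1), §6.31; this file, §1165] -/
theorem hermite_odd_zeros_laguerre {L L' : ℕ → ℝ[X]} {a b a' b' : ℕ → ℝ} (hL0 : L 0 = 1) (hL1 : L 1 = Polynomial.X - C (a 0))
    (hLrec : ∀ n, L (n + 2) = (Polynomial.X - C (a (n + 1))) * L (n + 1) - C (b (n + 1)) * L n) (ha : ∀ n, a n = 2 * n + 1 / 2)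
    (hb : ∀ n, b (n + 1) = ((n : ℝ) + 1) * ((n : ℝ) + 1 / 2))
    (hL0' : L' 0 = 1) (hL1' : L' 1 = Polynomial.X - C (a' 0)) (hLrec' : ∀ n, L' (n + 2) = (Polynomial.X - C (a' (n + 1))) * L' (n + 1) - C (b' (n + 1)) * L' n)
    (ha' : ∀ n, a' n = 2 * n + 3 / 2) (hb' : ∀ n, b' (n + 1) = ((n : ℝ) + 1) * ((n : ℝ) + 3 / 2))
    {t : ℕ} {z' : Fin (t + 1) → ℝ} (hz : ∀ k, 0 ≤ z' k) (hzq : L' (t + 1) = ∏ k, (Polynomial.X - C (z' k))) :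
    (Polynomial.hermite (2 * (t + 1) + 1)).map (Int.castRingHom ℝ) =
      Polynomial.X * ((∏ k, (Polynomial.X - C (Real.sqrt (2 * z' k)))) * ∏ k, (Polynomial.X - C (-Real.sqrt (2 * z' k)))) := by
  obtain ⟨-, hodd⟩ := hermite_even_odd_laguerre hL0 hL1 hLrec ha hb hL0' hL1' hLrec' ha' hb' (t + 1)
  obtain ⟨-, -, -, hprod⟩ := recurrence_scale_spec hL0' hL1' hLrec' (c := 2) two_ne_zero
  rw [hodd, hprod hzq, comp_X_sq_prod_eq fun k => by have := hz k; positivity]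

end Summit.Ventures.HSemireg.Wedge.HankelOuter
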